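import Literature.MathematicalPhysics.QuantumFieldTheory.Balaban1983to89.Node00.TorusCoverGaugeLift
import Literature.MathematicalPhysics.QuantumFieldTheory.Balaban1983to89.Node00.BoxStaircasePhase
import Literature.MathematicalPhysics.QuantumFieldTheory.Balaban1983to89.B7Prop2SpecialUnitary
import Literature.MathematicalPhysics.QuantumFieldTheory.Balaban1983to89.B8Eq184Proof

/-!
# NODE 00 — THE TORUS→`ℤᵈ` TWIN, FILE 3b: the `U(N) → SU(N)` NORMALISATION of a unitary gauge of an `SU(N)`-valued configuration on a box
# of `ℤᵈ` — [6] Prop. 6 ∕ Thm 2 hand over «a gauge transformation u» with values in the unitary group of `M_N(ℂ)` (tree: `∀ x, u x ∈ unitaryUnits 𝔸`),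
# while the record's gauges are `GaugeTransf (F.P K) 0 (SU N)`; the determinant phase of `u` is integrated along the coordinate staircase (FILE 3a) and
# divided out by its `N`-th root, at the price of the traceless correction `A ↦ A − (Re tr A ∕ N)·1` of the exponent

Cell `pub-ymgap`, seat `pub-ymgap-dag-n07-e` generation 10 (R141 (C) s3 «torus-vs-box twin», DAG node N07 = [15]; INTENT-25 programme FILE 27b, bus 2026-08-27).
NEW leaf; CONSUMED BY NAME, nothing modified: this seat's FILE 25 `Node00.TorusCoverGaugeLift` (p537387) and FILE 27a `Node00.BoxStaircasePhase`, b07's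
`B7Prop2SpecialUnitary.specialUnitaryUnits`, pub-verify's `ExpMeanLog.exp_smul_one_eq`, `Literature.Analysis.Matrix.det_exp_eq_exp_trace` (Liouville),
`MatrixNorms.norm_ntr_le_opNorm` ([3] (20)), n05-a's `B7Prop1Explicit.(Site, e, gaugeAct, expUnit)`, `B7Prop1Local.InBox`, lit-balaban's `B8Eq184Proof.cfgExp`, r11's `ιSU`.
`--kind definition --supports stmt-QuantumFields-20506` (K0⁶, WORDS-142).
[15] = [Balaban1985Variational]; [6] = [Balaban1985RegularSpaces]; [3] = [Balaban1985Averaging]; [I] = [Balaban1987RG1].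

WHY.  [6] Theorem 2 ∕ Proposition 6 (pp. 83, 99) and [15] (152) p. 301 produce «a gauge transformation u» for configurations with values «in a Lie subgroup G of
a unitary group U(N)» ([3] p. 18); the tree's kernel statements at NODE 00's `ℤᵈ × 𝔸` carriers (`Node00.GaugedBoundB8`, n05-c ∕ n05-e's `B8Prop6CubeMember*`)
hand over `u` with `∀ x, u x ∈ unitaryUnits 𝔸` — for `𝔸 = M_N(ℂ)` a `U(N)`-valued gauge — and it is NOT in the tree that `u` is `SU(N)`-valued when the data
are (the generalized axial gauge of the construction is built from block averages, which stay in `SU(N)` only at an `N`-dependent radius: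
`B7Prop2SpecialUnitary.avgClosedAt_specialUnitary`, `Nt < π`).  The record's gauges are `SU(N)`-valued (`Sect2.LocalGaugeOn`, `Gauge9RegSepTopStep`,
`Gauge152OfClassTopStep`: `∃ u : GaugeTransf (F.P K) 0 (SU N)`).  THIS FILE closes that gap on a BOX of the cover: if `g` is unitary, `V` has `det V = 1` and
`V^{g} = e^{iηA}` on the box's bonds with `A` self-adjoint and `ηN‖A‖` small, then `det V^{g}(x, x+e_μ) = det g(x)·det g(x+e_μ)⁻¹ = e^{iη tr A(x,μ)}`
(Liouville), so the determinant phase `λ = det ∘ g` moves by the small real angle `θ(x, μ) = η·Re tr A(x, μ)` along every bond; FILE 3a integrates `−θ` along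
the coordinate staircase to a real `Θ` with `λ = λ(lo)·e^{iΘ}` and `Θ(x + e_μ) − Θ(x) = −θ(x, μ)` on every bond of the box; dividing `g` by the `N`-th root
`c·e^{iΘ∕N}` of `λ` (`c^N = λ(lo)`) gives an `SU(N)`-valued gauge `s` with `V^{s} = e^{−iθ∕N}·V^{g} = e^{iη(A − (Re tr A∕N)·1)}` — the exponent loses its trace
part and keeps every bound up to a factor `2` (`norm_traceless_le`, `norm_traceless_sub_le`).  FILE 28 applies this to Prop. 6's gauge on the collared cube of
FILE 26 and pushes `s` down to the torus.

WHAT IS PROVED (kernel; `𝔸 = M_N(ℂ)` with the operator norm, `N ≥ 1` where stated; NO estimate of Bałaban).  `det_val_cfgExp`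
(`det e^{iηA} = e^{iη·tr A}`, Liouville) · `trace_eq_re_of_isSelfAdjoint` · `norm_trace_le_card_mul` (`|tr X| ≤ N‖X‖`, [3] (20)) · `norm_det_eq_one_of_mem_unitaryUnits` ·
`traceless` (1 def: `A − (Re tr A∕N)·1`) · `traceless_sub` · `norm_traceless_le` (`≤ 2‖A‖`) · `norm_traceless_sub_le` (`≤ 2‖A − A′‖`) ·
`smul_mem_specialUnitaryGroup` · `val_cfgExp_traceless` · ★★★ `exists_suGauge_of_unitaryGauge` (the normalisation: `∃ s : ℤᵈ → SU(N)` with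
`V^{ιSU ∘ s} = cfgExp η (traceless ∘ A)` on every bond of the box, under `(2W + 1)·ηN·r₀ < 2π`).
HONEST FRAMING: elementary; nothing of Bałaban asserted or discharged; N07 ∕ N05 ∕ K0⁶ NOT discharged; counts unmoved (5∕27); one finite T⁴ programme at fixed ε —
NOT continuum ∕ ℝ⁴ ∕ infinite volume ∕ OS ∕ mass gap ∕ Clay.  No `sorry`, no `instance`, no `notation`.
-/

noncomputable section

namespace Literature.MathematicalPhysics.QuantumFieldTheory.Balaban1983to89.Node00

open scoped Matrix.Norms.L2Operator
open Complex (I)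
open NormedSpace (exp)
open B7Prop1Explicit (e e_apply expUnit val_expUnit)
open B7Prop1Local (InBox)
open B7Prop2Explicit (unitaryUnits mem_unitaryUnits)
open B7Prop2SpecialUnitary (specialUnitaryUnits mem_specialUnitaryUnits)
open B8Eq184Proof (cfgExp)

/-! ## §2  `M_N(ℂ)`: Liouville on `e^{iηA}`, the trace part, the `SU(N)` normalisation of a unitary gauge on a box -/

section Matrices

variable {N : ℕ} [NeZero N]

omit [NeZero N] in
/-- Real scalars act on `M_N(ℂ)` through `ℝ ⊂ ℂ`. [folklore] -/
private theorem real_smul_eq_coe_smul_matA (r : ℝ) (X : MatA N) : r • X = (r : ℂ) • X :=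
  RCLike.real_smul_eq_coe_smul (K := ℂ) r X

omit [NeZero N] in
/-- **LIOUVILLE ON THE EXPONENTIAL FORM**: `det e^{iηA} = e^{iη·tr A}` (`Literature.Analysis.Matrix.det_exp_eq_exp_trace`). [cite: Balaban1985RegularSpaces, (1.36) p.82 («U₁ = exp iηA»; Liouville bookkeeping)] -/
theorem det_val_cfgExp {d : ℕ} (η : ℝ) (A : B7Prop1Explicit.Site d → Fin d → MatA N) (x : B7Prop1Explicit.Site d) (μ : Fin d) :
    ((cfgExp η A x μ : (MatA N)ˣ) : MatA N).det = Complex.exp (I * η * (A x μ).trace) := by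
  rw [cfgExp, val_expUnit, Literature.Analysis.Matrix.det_exp_eq_exp_trace, Complex.exp_eq_exp_ℂ,
    real_smul_eq_coe_smul_matA, smul_smul, Matrix.trace_smul, smul_eq_mul]

omit [NeZero N] in
/-- The trace of a self-adjoint matrix is real. [cite: Balaban1985Averaging, p.20 («hermitian matrices»; bookkeeping)] -/
theorem trace_eq_re_of_isSelfAdjoint {X : MatA N} (h : IsSelfAdjoint X) : X.trace = ((X.trace).re : ℂ) := by
  have h1 : star X.trace = X.trace := by
    rw [← Matrix.trace_conjTranspose]
    exact congrArg Matrix.trace h.star_eq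
  exact (Complex.conj_eq_iff_re.1 h1).symm

/-- [3] (20) «|tr X| ≤ |X|» for the normalized trace, i.e. `‖tr X‖ ≤ N·‖X‖` (`MatrixNorms.norm_ntr_le_opNorm`). [cite: Balaban1985Averaging, (20) p.21] -/
theorem norm_trace_le_card_mul (X : MatA N) : ‖X.trace‖ ≤ N * ‖X‖ := by
  have h := MatrixNorms.norm_ntr_le_opNorm X
  have hN : (0 : ℝ) < N := Nat.cast_pos.2 (NeZero.pos N)
  rw [MatrixNorms.ntr, Fintype.card_fin, norm_div, Complex.norm_natCast, div_le_iff₀ hN] at h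
  linarith [mul_comm (N : ℝ) ‖X‖]

omit [NeZero N] in
/-- A unitary matrix has a determinant of modulus one. [cite: Balaban1985Averaging, p.18 («values in … a unitary group U(N)»; bookkeeping)] -/
theorem norm_det_eq_one_of_mem_unitaryUnits {u : (MatA N)ˣ} (h : u ∈ unitaryUnits (MatA N)) : ‖(u : MatA N).det‖ = 1 := by
  have hu : star (u : MatA N) * (u : MatA N) = 1 := Unitary.star_mul_self_of_mem (mem_unitaryUnits.1 h)
  have h1 := congrArg Matrix.det hu
  rw [Matrix.det_mul, Matrix.star_eq_conjTranspose, Matrix.det_conjTranspose, Matrix.det_one, Complex.star_def,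
    ← Complex.normSq_eq_conj_mul_self] at h1
  have h2 : Complex.normSq (u : MatA N).det = 1 := by exact_mod_cast h1
  have h3 : ‖(u : MatA N).det‖ ^ 2 = 1 := by rw [Complex.sq_norm, h2]
  exact (pow_eq_one_iff_of_nonneg (norm_nonneg _) two_ne_zero).1 h3

omit [NeZero N] in
/-- The determinant of the inverse unit is the inverse determinant. [folklore] -/
private theorem det_val_inv_units (u : (MatA N)ˣ) : ((u⁻¹ : (MatA N)ˣ) : MatA N).det = ((u : MatA N).det)⁻¹ := by
  have h := congrArg Matrix.det u.inv_mul
  rw [Matrix.det_mul, Matrix.det_one] at h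
  exact eq_inv_of_mul_eq_one_left h

/-- **THE TRACELESS PART** `A − (Re tr A ∕ N)·1` of an exponent (for self-adjoint `A` this removes exactly the `u(1)`-component; a plumbing definition). [folklore] -/
def traceless (X : MatA N) : MatA N := X - (((X.trace).re / N : ℝ) : ℂ) • (1 : MatA N)

omit [NeZero N] in
/-- The traceless part is linear: `traceless X − traceless Y = traceless (X − Y)`. [cite: Balaban1985Averaging, (20) p.21 (bookkeeping)] -/
theorem traceless_sub (X Y : MatA N) : traceless X - traceless Y = traceless (X - Y) := by
  simp only [traceless, Matrix.trace_sub, Complex.sub_re, sub_div, Complex.ofReal_sub, sub_smul]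
  abel

/-- `‖traceless X‖ ≤ 2‖X‖` (`|Re tr X| ∕ N ≤ ‖X‖` by [3] (20)). [cite: Balaban1985Averaging, (20) p.21] -/
theorem norm_traceless_le (X : MatA N) : ‖traceless X‖ ≤ 2 * ‖X‖ := by
  letI : CStarAlgebra (MatA N) := {}
  have hN : (0 : ℝ) < N := Nat.cast_pos.2 (NeZero.pos N)
  have h1 : ‖(((X.trace).re / N : ℝ) : ℂ) • (1 : MatA N)‖ ≤ ‖X‖ := by
    rw [norm_smul, norm_one, mul_one, Complex.norm_real, Real.norm_eq_abs, abs_div, abs_of_pos hN, div_le_iff₀ hN]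
    calc |(X.trace).re| ≤ ‖X.trace‖ := Complex.abs_re_le_norm _
      _ ≤ N * ‖X‖ := norm_trace_le_card_mul X
      _ = ‖X‖ * N := mul_comm _ _
  calc ‖traceless X‖ ≤ ‖X‖ + ‖(((X.trace).re / N : ℝ) : ℂ) • (1 : MatA N)‖ := norm_sub_le _ _
    _ ≤ ‖X‖ + ‖X‖ := by linarith
    _ = 2 * ‖X‖ := by ring

/-- `‖traceless X − traceless Y‖ ≤ 2‖X − Y‖`. [cite: Balaban1985Averaging, (20) p.21] -/
theorem norm_traceless_sub_le (X Y : MatA N) : ‖traceless X - traceless Y‖ ≤ 2 * ‖X - Y‖ := by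
  rw [traceless_sub]; exact norm_traceless_le _

/-- The box predicate, coordinatewise (decidable spelling of `B7Prop1Local.InBox` for the case split in `suGaugeOf`). [folklore] -/
private theorem inBox_iff_forall {d : ℕ} (lo hi y : B7Prop1Explicit.Site d) : InBox lo hi y ↔ ∀ i, lo i ≤ y i ∧ y i ≤ hi i := Iff.rfl

omit [NeZero N] in
/-- A unit complex scalar times a unitary matrix with the right determinant is special unitary: `‖m‖ = 1`, `g` unitary, `m⁻ᴺ·det g = 1`. [cite: Balaban1985Averaging, p.20 («The group G is obtained by applying the function e^{iA} to A ∈ 𝔤», G = SU(N); bookkeeping)] -/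
theorem smul_mem_specialUnitaryGroup {m : ℂ} (hm : ‖m‖ = 1) {g : MatA N} (hg : g ∈ unitary (MatA N)) (hdet : m ^ N = g.det) :
    m⁻¹ • g ∈ Matrix.specialUnitaryGroup (Fin N) ℂ := by
  have hm0 : m ≠ 0 := fun h => by rw [h, norm_zero] at hm; exact zero_ne_one hm
  rw [Matrix.mem_specialUnitaryGroup_iff]
  constructor
  · rw [Matrix.mem_unitaryGroup_iff, star_smul, Matrix.smul_mul, Matrix.mul_smul, smul_smul]
    have h1 : g * star g = 1 := Unitary.mul_star_self_of_mem hg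
    rw [h1]
    have h2 : m⁻¹ * star m⁻¹ = 1 := by
      rw [Complex.star_def, Complex.mul_conj, map_inv₀, Complex.normSq_eq_norm_sq, hm]
      norm_num
    rw [h2, one_smul]
  · rw [Matrix.det_smul, Fintype.card_fin, ← hdet, inv_pow, inv_mul_cancel₀ (pow_ne_zero _ hm0)]

omit [NeZero N] in
/-- The exponential of the traceless part: `e^{iη(A − (Re tr A∕N)·1)} = e^{−iη·Re tr A∕N} · e^{iηA}` (the scalar part commutes out). [cite: Balaban1985RegularSpaces, (1.36) p.82 (bookkeeping)] -/
theorem val_cfgExp_traceless {d : ℕ} (η : ℝ) (A : B7Prop1Explicit.Site d → Fin d → MatA N) (x : B7Prop1Explicit.Site d) (μ : Fin d) :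
    ((cfgExp η (fun y ν => traceless (A y ν)) x μ : (MatA N)ˣ) : MatA N) =
      Complex.exp (-(I * ↑(η * ((A x μ).trace).re) / N)) • ((cfgExp η A x μ : (MatA N)ˣ) : MatA N) := by
  rw [cfgExp, cfgExp, val_expUnit, val_expUnit, traceless, real_smul_eq_coe_smul_matA, real_smul_eq_coe_smul_matA, smul_smul,
    smul_smul, smul_sub, smul_smul, sub_eq_add_neg, ← neg_smul,
    Matrix.exp_add_of_commute _ _ ((Commute.one_right _).smul_right _), ExpMeanLog.exp_smul_one_eq, mul_smul_comm, mul_one]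
  congr 2
  push_cast
  ring

/-- ★★★ **THE `U(N) → SU(N)` NORMALISATION OF A UNITARY GAUGE ON A BOX.**  Let `V` be a bond configuration with `det V = 1` on the bonds of the box `[lo, hi]`,
`g` a site function unitary on the box, and `V^{g} = e^{iηA}` on the box's bonds (n05-a's `gaugeAct`, lit-balaban's `cfgExp`) with `A` self-adjoint,
`‖A‖ ≤ r₀` there and `(2W + 1)·ηN·r₀ < 2π` (`W` the total width of the box).  Then there is an `SU(N)`-VALUED gauge `s` (Mathlib's
`Matrix.specialUnitaryGroup`, read into the units through r11's `ιSU`) with `V^{s} = e^{iη·(A − (Re tr A∕N)·1)}` on every bond of the box — the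
determinant phase `det g` is divided out by its `N`-th root along the coordinate staircase (§1), the exponent loses its trace part.
[cite: Balaban1985RegularSpaces, Prop. 6 p.99 («there exists a gauge transformation u defined on □̃»), Thm 2 p.83; Balaban1985Averaging, p.18 («values in a Lie subgroup G of a unitary group U(N)»)] -/
theorem exists_suGauge_of_unitaryGauge {d : ℕ} (lo hi : B7Prop1Explicit.Site d) {η : ℝ} (hη : 0 ≤ η)
    (V : B7Prop1Explicit.Site d → Fin d → (MatA N)ˣ) (g : B7Prop1Explicit.Site d → (MatA N)ˣ) (A : B7Prop1Explicit.Site d → Fin d → MatA N) {r₀ : ℝ}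
    (hr₀ : 0 ≤ r₀)
    (hV : ∀ x μ, InBox lo hi x → InBox lo hi (x + e μ) → ((V x μ : (MatA N)ˣ) : MatA N).det = 1)
    (hg : ∀ x, InBox lo hi x → g x ∈ unitaryUnits (MatA N))
    (hgauge : ∀ x μ, InBox lo hi x → InBox lo hi (x + e μ) → B7Prop1Explicit.gaugeAct g V x μ = cfgExp η A x μ)
    (hsa : ∀ x μ, InBox lo hi x → InBox lo hi (x + e μ) → IsSelfAdjoint (A x μ))
    (hA : ∀ x μ, InBox lo hi x → InBox lo hi (x + e μ) → ‖A x μ‖ ≤ r₀)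
    (hsmall : (2 * boxWidth lo hi + 1) * (η * N * r₀) < 2 * Real.pi) :
    ∃ s : B7Prop1Explicit.Site d → Matrix.specialUnitaryGroup (Fin N) ℂ, ∀ x μ, InBox lo hi x → InBox lo hi (x + e μ) →
      B7Prop1Explicit.gaugeAct (fun y => ιSU N (s y)) V x μ = cfgExp η (fun y ν => traceless (A y ν)) x μ := by
  classical
  have hNpos : 0 < N := NeZero.pos N
  have hN : (0 : ℝ) < N := Nat.cast_pos.2 hNpos
  -- empty box: nothing to prove
  by_cases hne : InBox lo hi lo
  swap
  · refine ⟨fun _ => 1, fun x μ hx _ => (hne fun i => ⟨le_rfl, (hx i).1.trans (hx i).2⟩).elim⟩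
  -- the determinant phase and its bond angles
  set lam : B7Prop1Explicit.Site d → ℂ := fun y => ((g y : (MatA N)ˣ) : MatA N).det with hlam
  set θ : B7Prop1Explicit.Site d → Fin d → ℝ := fun y μ => η * ((A y μ).trace).re with hθ
  have hlam1 : ∀ y, InBox lo hi y → ‖lam y‖ = 1 := fun y hy => norm_det_eq_one_of_mem_unitaryUnits (hg y hy)
  have hlam0 : ∀ y, InBox lo hi y → lam y ≠ 0 := fun y hy h => by
    have := hlam1 y hy; rw [h, norm_zero] at this; exact zero_ne_one this
  -- Liouville: `det V^{g}(b) = λ(x)·λ(x+e_μ)⁻¹ = e^{iθ(b)}`, i.e. `λ(x+e_μ) = λ(x)·e^{−iθ(b)}`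
  have hstep : ∀ y μ, InBox lo hi y → InBox lo hi (y + e μ) → lam (y + e μ) = lam y * Complex.exp (I * ↑(-θ y μ)) := by
    intro y μ hy hy'
    have h1 := congrArg (fun u : (MatA N)ˣ => (u : MatA N).det) (hgauge y μ hy hy')
    simp only [B7Prop1Explicit.gaugeAct, Units.val_mul, Matrix.det_mul, det_val_inv_units, hV y μ hy hy', mul_one,
      det_val_cfgExp] at h1
    rw [trace_eq_re_of_isSelfAdjoint (hsa y μ hy hy')] at h1
    -- `h1 : lam y * (lam (y + e μ))⁻¹ = exp (I * η * re tr A)`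
    have h2 : lam y * (lam (y + e μ))⁻¹ = Complex.exp (I * θ y μ) := by
      rw [hθ]; dsimp only; push_cast; rw [← mul_assoc]; exact h1
    have h3 : lam (y + e μ) ≠ 0 := hlam0 _ hy'
    have h4 : lam y ≠ 0 := hlam0 _ hy
    calc lam (y + e μ) = lam y * (lam y * (lam (y + e μ))⁻¹)⁻¹ := by field_simp
      _ = lam y * Complex.exp (I * ↑(-θ y μ)) := by rw [h2, ← Complex.exp_neg]; push_cast; ring_nf
  -- the bond angles are small: `|θ| ≤ ηN r₀`
  have hτ : ∀ y μ, InBox lo hi y → InBox lo hi (y + e μ) → |(-θ y μ)| ≤ η * N * r₀ := by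
    intro y μ hy hy'
    rw [abs_neg, hθ]
    dsimp only
    rw [abs_mul, abs_of_nonneg hη, mul_assoc]
    refine mul_le_mul_of_nonneg_left ?_ hη
    calc |((A y μ).trace).re| ≤ ‖(A y μ).trace‖ := Complex.abs_re_le_norm _
      _ ≤ N * ‖A y μ‖ := norm_trace_le_card_mul _
      _ ≤ N * r₀ := mul_le_mul_of_nonneg_left (hA y μ hy hy') hN.le
  have hτ0 : 0 ≤ η * N * r₀ := by positivity
  -- the `N`-th root of the phase: `c^N = λ(lo)`, `μf y = c·e^{iS(y)∕N}`, `S = stairSum (−θ)`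
  obtain ⟨c, hc⟩ := IsAlgClosed.exists_pow_nat_eq (lam lo) hNpos
  have hc1 : ‖c‖ = 1 := by
    have h := congrArg (fun z : ℂ => ‖z‖) hc
    simp only [norm_pow, hlam1 lo hne] at h
    exact (pow_eq_one_iff_of_nonneg (norm_nonneg c) hNpos.ne').1 h
  set S : B7Prop1Explicit.Site d → ℝ := fun y => stairSum lo (fun y μ => -θ y μ) y with hS
  set μf : B7Prop1Explicit.Site d → ℂ := fun y => c * Complex.exp (I * ↑(S y) / N) with hμf
  have hμ1 : ∀ y, ‖μf y‖ = 1 := fun y => by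
    rw [hμf]; dsimp only
    rw [norm_mul, hc1, one_mul, show (I * ↑(S y) / N : ℂ) = ↑(S y / N) * I by push_cast; ring, Complex.norm_exp_ofReal_mul_I]
  have hμN : ∀ y, InBox lo hi y → μf y ^ N = lam y := by
    intro y hy
    rw [hμf]; dsimp only
    have hN' : (N : ℂ) ≠ 0 := by exact_mod_cast hNpos.ne'
    rw [mul_pow, hc, ← Complex.exp_nat_mul, lam_eq_mul_exp_stairSum hy hstep]
    congr 2
    simp only [hS]
    field_simp
  have hμ0 : ∀ y, μf y ≠ 0 := fun y h => by have := hμ1 y; rw [h, norm_zero] at this; exact zero_ne_one this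
  -- exactness of the staircase phase on every bond of the box
  have hexact : ∀ y μ, InBox lo hi y → InBox lo hi (y + e μ) → S (y + e μ) - S y = -θ y μ := fun y μ hy hy' =>
    stairSum_add_e_sub_eq hy hy' hstep (hlam0 lo hne) hτ0 hτ hsmall
  -- the `SU(N)`-valued gauge
  have hmem : ∀ y, InBox lo hi y → (μf y)⁻¹ • ((g y : (MatA N)ˣ) : MatA N) ∈ Matrix.specialUnitaryGroup (Fin N) ℂ := fun y hy =>
    smul_mem_specialUnitaryGroup (hμ1 y) (mem_unitaryUnits.1 (hg y hy)) (hμN y hy)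
  let s : B7Prop1Explicit.Site d → Matrix.specialUnitaryGroup (Fin N) ℂ := fun y =>
    if h : ∀ i, lo i ≤ y i ∧ y i ≤ hi i then ⟨(μf y)⁻¹ • ((g y : (MatA N)ˣ) : MatA N), hmem y h⟩ else 1
  have hs : ∀ y, InBox lo hi y → ((ιSU N (s y) : (MatA N)ˣ) : MatA N) = (μf y)⁻¹ • ((g y : (MatA N)ˣ) : MatA N) := by
    intro y hy
    rw [coe_ιSU]
    simp only [s, dif_pos ((inBox_iff_forall lo hi y).1 hy)]
  have hsinv : ∀ y, InBox lo hi y → (((ιSU N (s y))⁻¹ : (MatA N)ˣ) : MatA N) = (μf y) • (((g y)⁻¹ : (MatA N)ˣ) : MatA N) := by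
    intro y hy
    refine Units.inv_eq_of_mul_eq_one_right ?_
    rw [hs y hy, Matrix.smul_mul, Matrix.mul_smul, smul_smul, Units.mul_inv, inv_mul_cancel₀ (hμ0 y), one_smul]
  refine ⟨s, fun x μ hx hx' => ?_⟩
  apply Units.ext
  have hval := congrArg (fun u : (MatA N)ˣ => (u : MatA N)) (hgauge x μ hx hx')
  simp only [B7Prop1Explicit.gaugeAct, Units.val_mul] at hval ⊢
  rw [hs x hx, hsinv (x + e μ) hx', Matrix.smul_mul, Matrix.smul_mul, Matrix.mul_smul, smul_smul, hval]
  -- `μ(x)⁻¹·μ(x+e_μ) = e^{−iθ∕N}`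
  have hratio : (μf x)⁻¹ * μf (x + e μ) = Complex.exp (-(I * ↑(η * ((A x μ).trace).re) / N)) := by
    have hc0 : c ≠ 0 := fun h => by rw [h, norm_zero] at hc1; exact zero_ne_one hc1
    have h1 : (μf x)⁻¹ * μf (x + e μ) = Complex.exp (I * ↑(S (x + e μ)) / N - I * ↑(S x) / N) := by
      rw [Complex.exp_sub, hμf]
      dsimp only
      have he : Complex.exp (I * ↑(S x) / N) ≠ 0 := Complex.exp_ne_zero _
      field_simp
    rw [h1]
    congr 1
    have h2 : ((S (x + e μ) : ℝ) : ℂ) - ↑(S x) = -↑(θ x μ) := by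
      rw [← Complex.ofReal_sub, hexact x μ hx hx']; push_cast; rfl
    calc I * ↑(S (x + e μ)) / ↑N - I * ↑(S x) / ↑N = I * (↑(S (x + e μ)) - ↑(S x)) / N := by ring
      _ = -(I * ↑(η * ((A x μ).trace).re) / N) := by rw [h2, hθ]; ring
  rw [hratio, val_cfgExp_traceless]

end Matrices

end Literature.MathematicalPhysics.QuantumFieldTheory.Balaban1983to89.Node00

end
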